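import Summits.Parity.GeneralizedHardyLittlewood.Theorems.LiouvilleShiftedTablesSieveToMAvgScaleOK
import Mathlib.NumberTheory.Harmonic.Bounds

/-!
# Sieve glue for `SieveToMAvg`, part 12c: the size of the Type-II majorant

Support file for item stmt-Parity-14274 (route `LiouvilleShiftedTables`).  Elementary size facts at a
dyadic scale `x ∈ [Y/(2(log Y)^{13}), Y/2]` of a large height `Y` (`L = log Y`): `H_t ≤ 1 + log t`,
`ℓ ≤ 2L`, `Kff ≤ 3L^{A₁+1}`, and with the Type-II exponent `C = 4C₄`,
`(Y²/L^C)^{1/4} = √Y/L^{C₄}`, whence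

  `BII ≤ 48 · 2^e Cτ · Y / L^{C₄ − A₁ − e − 2}`   (`BII_le`).
-/

namespace Summit.Parity.GeneralizedHardyLittlewood.Theorems.SieveToMAvg

open Finset Real Filter
open scoped ArithmeticFunction.zeta ArithmeticFunction.sigma ArithmeticFunction.vonMangoldt

/-! ### Harmonic sums and the logarithmic factor -/

/-- `H_t ≤ 1 + log t` for `t ≥ 1` (`harmonic_le_one_add_log`). [folklore] -/
theorem Hsum_le_log {t : ℝ} (ht : 1 ≤ t) : Hsum t ≤ 1 + Real.log t := by
  have h := harmonic_le_one_add_log ⌊t⌋₊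
  simp_rw [harmonic_eq_sum_Icc, Rat.cast_sum, Rat.cast_inv, Rat.cast_natCast] at h
  unfold Hsum
  refine h.trans ?_
  have hfl : (1 : ℝ) ≤ ⌊t⌋₊ := by exact_mod_cast Nat.le_floor (by simpa using ht)
  linarith [Real.log_le_log (by linarith) (Nat.floor_le (by linarith) : (⌊t⌋₊ : ℝ) ≤ t)]

/-- `H_t ≤ 2 log Y` for `1 ≤ t ≤ Y`, `log Y ≥ 1`. [folklore] -/
theorem Hsum_le_two_log {t Y : ℝ} (ht : 1 ≤ t) (htY : t ≤ Y) (hL : 1 ≤ Real.log Y) : Hsum t ≤ 2 * Real.log Y := by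
  have := Hsum_le_log ht
  have h2 : Real.log t ≤ Real.log Y := Real.log_le_log (by linarith) htY
  linarith

/-- `ℓ = 1 + log(2^{2j}·2x) ≤ 2 log Y` for `j ≤ 3`, `2x ≤ Y`, `x > 0`, `log Y ≥ 1 + log 64`. [folklore] -/
theorem ell2_le {j : ℕ} (hj : j ≤ 3) {x Y : ℝ} (hx : 0 < x) (hxY : 2 * x ≤ Y) (hL : 1 + Real.log 64 ≤ Real.log Y) :
    ell2 j x ≤ 2 * Real.log Y := by
  unfold ell2
  have hpow : (2 : ℝ) ^ (2 * j) ≤ 64 := by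
    calc (2 : ℝ) ^ (2 * j) ≤ 2 ^ 6 := pow_le_pow_right₀ (by norm_num) (by omega)
      _ = 64 := by norm_num
  have h1 : Real.log (2 ^ (2 * j) * (2 * x)) ≤ Real.log (64 * Y) :=
    Real.log_le_log (by positivity) (mul_le_mul hpow hxY (by linarith) (by norm_num))
  have h2 : Real.log (64 * Y) = Real.log 64 + Real.log Y := Real.log_mul (by norm_num) (by linarith)
  linarith

/-- `Kff ≤ 3 (log Y)^{A₁+1}` once `log Y ≥ 4` (and `(log Y)^{A₁} ≥ 2`, `Y ≥ 1`). [folklore] -/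
theorem Kff_le_three {A₁ : ℕ} {Y : ℝ} (hY : 1 ≤ Y) (hL : 4 ≤ Real.log Y) (hLA : 2 ≤ Real.log Y ^ A₁) :
    (Kff A₁ Y : ℝ) ≤ 3 * Real.log Y ^ (A₁ + 1) := by
  obtain ⟨hΔ0, hΔh⟩ := Δf_bounds hLA
  have h := Kff_le (A₁ := A₁) (by linarith) hΔ0 (by linarith)
  have hl2 : Real.log 2 ≤ 1 := by
    have := Real.log_two_lt_d9; linarith
  have hlog2Y : Real.log (2 * Y) ≤ (5 / 4) * Real.log Y := by
    rw [Real.log_mul (by norm_num) (by linarith)]; linarith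
  have hLA1 : Real.log Y ^ (A₁ + 1) = Real.log Y ^ A₁ * Real.log Y := pow_succ _ _
  have hbig : 8 ≤ Real.log Y ^ (A₁ + 1) := by rw [hLA1]; nlinarith
  have hpos : 0 ≤ Real.log Y ^ A₁ := by positivity
  calc (Kff A₁ Y : ℝ) ≤ 2 * Real.log (2 * Y) * Real.log Y ^ A₁ + 2 := h
    _ ≤ 2 * ((5 / 4) * Real.log Y) * Real.log Y ^ A₁ + 2 := by gcongr
    _ = (5 / 2) * Real.log Y ^ (A₁ + 1) + 2 := by rw [hLA1]; ring
    _ ≤ 3 * Real.log Y ^ (A₁ + 1) := by linarith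

/-! ### The Type-II factor -/

/-- With `C = 4C₄`: `(Y²/L^C)^{1/4} = √Y / L^{C₄}` (`Y ≥ 0`, `L = log Y > 0`). [folklore] -/
theorem Wroot_eq {Y : ℝ} (hY : 0 ≤ Y) (hL : 0 < Real.log Y) (C₄ : ℕ) :
    (Y ^ 2 / Real.log Y ^ (((4 * C₄ : ℕ) : ℝ))) ^ ((1 : ℝ) / 4) = Real.sqrt Y / Real.log Y ^ C₄ := by
  rw [Real.rpow_natCast]
  have hbase : Y ^ 2 / Real.log Y ^ (4 * C₄) = (Real.sqrt Y / Real.log Y ^ C₄) ^ 4 := by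
    rw [div_pow, ← pow_mul, mul_comm C₄ 4]
    congr 1
    rw [show (4 : ℕ) = 2 * 2 from rfl, pow_mul, Real.sq_sqrt hY]
  rw [hbase, show ((1 : ℝ) / 4) = ((4 : ℕ) : ℝ)⁻¹ by norm_num]
  exact Real.pow_rpow_inv_natCast (by positivity) (by norm_num)

/-- `L^a / L^b = (L^{b−a})⁻¹` for `a ≤ b`, `L ≠ 0`. [folklore] -/
theorem pow_div_pow_eq_inv {L : ℝ} (hL : L ≠ 0) {a b : ℕ} (hab : a ≤ b) : L ^ a / L ^ b = (L ^ (b - a))⁻¹ := by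
  have : L ^ b = L ^ a * L ^ (b - a) := by rw [← pow_add, Nat.add_sub_cancel' hab]
  rw [this, ← div_div, div_self (pow_ne_zero _ hL), one_div]

/-- **The size of `BII`**: with `C = 4C₄`, `Kf = Kff A₁ Y`, at a scale `2x ≤ Y` (`x > 0`), for
`j ≤ 3`, `1 ≤ Q ≤ Y`, `log Y ≥ 4 + log 64`, `(log Y)^{A₁} ≥ 2`, `Cτ ≥ 0`, `C₄ ≥ A₁ + e + 2`:
`BII ≤ 48 · 2^e · Cτ · Y / L^{C₄ − (A₁ + e + 2)}`. [folklore] -/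
theorem BII_le {j A₁ e C₄ Q : ℕ} (hj : j ≤ 3) {x Y Cτ : ℝ} (hx : 1 ≤ x) (hxY : 2 * x ≤ Y)
    (hL : 4 + Real.log 64 ≤ Real.log Y) (hLA : 2 ≤ Real.log Y ^ A₁) (hQ1 : 1 ≤ Q) (hQY : (Q : ℝ) ≤ Y)
    (hCτ : 0 ≤ Cτ) (hC₄ : A₁ + e + 2 ≤ C₄) :
    BII j x Y (((4 * C₄ : ℕ) : ℝ)) Cτ e (Kff A₁ Y) Q ≤
      48 * 2 ^ e * Cτ * Y / Real.log Y ^ (C₄ - (A₁ + e + 2)) := by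
  set L := Real.log Y with hLdef
  have hl64 : 0 < Real.log 64 := Real.log_pos (by norm_num)
  have hL4 : 4 ≤ L := by linarith
  have hL1 : 1 ≤ L := by linarith
  have hL0 : 0 < L := by linarith
  have hx0 : 0 < x := by linarith
  have hY1 : 1 ≤ Y := by linarith
  have hY0 : 0 ≤ Y := by linarith
  -- the factors
  have hKf : (Kff A₁ Y : ℝ) ≤ 3 * L ^ (A₁ + 1) := Kff_le_three hY1 hL4 hLA
  have hKf1 : (1 : ℝ) ≤ Kff A₁ Y := by
    have : 1 ≤ Kff A₁ Y := by unfold Kff; omega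
    exact_mod_cast this
  have hsqKf : Real.sqrt (Kff A₁ Y) ≤ 3 * L ^ (A₁ + 1) := by
    calc Real.sqrt (Kff A₁ Y) ≤ Real.sqrt ((Kff A₁ Y : ℝ) ^ 2) := Real.sqrt_le_sqrt (by nlinarith)
      _ = (Kff A₁ Y : ℝ) := Real.sqrt_sq (by positivity)
      _ ≤ 3 * L ^ (A₁ + 1) := hKf
  have hℓ : ell2 j x ≤ 2 * L := ell2_le hj hx0 hxY (by linarith)
  have hℓ1 : 1 ≤ ell2 j x := one_le_ell2 j (by linarith)
  have hℓe : ell2 j x ^ e ≤ (2 * L) ^ e := pow_le_pow_left₀ (by linarith) hℓ e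
  have h2j : (2 : ℝ) ^ j ≤ 8 := by
    calc (2 : ℝ) ^ j ≤ 2 ^ 3 := pow_le_pow_right₀ (by norm_num) hj
      _ = 8 := by norm_num
  have hsx : Real.sqrt (2 * x) ≤ Real.sqrt Y := Real.sqrt_le_sqrt hxY
  have hHQ : (∑ q ∈ Icc 1 Q, (q : ℝ)⁻¹) ≤ 2 * L := by
    have := Hsum_le_two_log (t := (Q : ℝ)) (by exact_mod_cast hQ1) hQY hL1
    rwa [Hsum_natCast] at this
  have hHQ0 : 0 ≤ ∑ q ∈ Icc 1 Q, (q : ℝ)⁻¹ := Finset.sum_nonneg fun _ _ => by positivity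
  have hH34 : (∑ q ∈ Icc 1 Q, (q : ℝ)⁻¹) ^ ((3 : ℝ) / 4) ≤ 2 * L := by
    have h1 : (∑ q ∈ Icc 1 Q, (q : ℝ)⁻¹) ^ ((3 : ℝ) / 4) ≤ (2 * L) ^ ((3 : ℝ) / 4) :=
      Real.rpow_le_rpow hHQ0 hHQ (by norm_num)
    have h2 : (2 * L) ^ ((3 : ℝ) / 4) ≤ (2 * L) ^ (1 : ℝ) :=
      Real.rpow_le_rpow_of_exponent_le (by linarith) (by norm_num)
    rw [Real.rpow_one] at h2
    exact h1.trans h2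
  have hW : Wfac Y (((4 * C₄ : ℕ) : ℝ)) Q ≤ Real.sqrt Y / L ^ C₄ * (2 * L) := by
    unfold Wfac
    rw [Wroot_eq hY0 hL0 C₄]
    exact mul_le_mul_of_nonneg_left hH34 (by positivity)
  -- assemble
  unfold BII
  have hmid : Cτ * 2 ^ j * Real.sqrt (2 * x) * ell2 j x ^ e ≤ Cτ * 8 * Real.sqrt Y * (2 * L) ^ e := by
    have := Real.sqrt_nonneg (2 * x)
    have : 0 ≤ ell2 j x ^ e := by positivity
    gcongr
  have hmid0 : 0 ≤ Cτ * 2 ^ j * Real.sqrt (2 * x) * ell2 j x ^ e := by positivity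
  have hW0 : 0 ≤ Wfac Y (((4 * C₄ : ℕ) : ℝ)) Q := Wfac_nonneg hY1 _ Q
  calc Real.sqrt (Kff A₁ Y) * (Cτ * 2 ^ j * Real.sqrt (2 * x) * ell2 j x ^ e) * Wfac Y (((4 * C₄ : ℕ) : ℝ)) Q
      ≤ (3 * L ^ (A₁ + 1)) * (Cτ * 8 * Real.sqrt Y * (2 * L) ^ e) * (Real.sqrt Y / L ^ C₄ * (2 * L)) := by
        refine mul_le_mul (mul_le_mul hsqKf hmid hmid0 (by positivity)) hW hW0 (by positivity)
    _ = 48 * 2 ^ e * Cτ * (Real.sqrt Y * Real.sqrt Y) * (L ^ (A₁ + 1 + e + 1) / L ^ C₄) := by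
        rw [mul_pow]; ring
    _ = 48 * 2 ^ e * Cτ * Y * (L ^ (A₁ + e + 2) / L ^ C₄) := by
        rw [Real.mul_self_sqrt hY0, show A₁ + 1 + e + 1 = A₁ + e + 2 by ring]
    _ = 48 * 2 ^ e * Cτ * Y / L ^ (C₄ - (A₁ + e + 2)) := by
        rw [pow_div_pow_eq_inv hL0.ne' hC₄, div_eq_mul_inv]

end Summit.Parity.GeneralizedHardyLittlewood.Theorems.SieveToMAvg
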